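import Mathlib
import HarnessLib

/-!
# Route `RadicialJung`, crux `CleanModels` (stmt-ResolutionOfSingularities-15917), line `Sketch` rev 35, stub 6 `stub_cleanProp44` (X44c):
# ONE STEP OF THE LEAF TOWER ON ELEMENTS — the normal form `Σ_e t^e v^{k_e} h_e` under a division, and the `δ`-face at the end (census (iii-3) (a)–(b))

Seat decomp-res-hand-2 g20 (structural hand); companion of ✓ `…CleanProp44LeafOrderDivision.lean` (the same step on IDEALS).  Memo 4e §2.5 follows an element
`f = Σ_{e ≤ μ} t^e g_e ∈ J` (`g_e ∈ 𝔪^{(μ−e)δ}`) through `δ` divisions «chart `u₁`: `t = t_j u₁^j`» and reads at the end, modulo `u₁`, THE `δ`-FACE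
`Σ_e t_δ^e C_e(u₂′)` with `C_e = ` the degree-`(μ−e)δ` initial form of `g_e` dehomogenised.  This file types the element-level bookkeeping for an ABSTRACT chart
map `ψ` (as in hand-2 g18's abstract chart data: `ψ(x_i) = v · y_i`), def-free:

* `map_eval_eq_pow_mul_eval₂_of_isHomogeneous` — a homogeneous form of degree `n` in generators `x` with `ψ(x_i) = v·y_i` maps to `v^n · G(y)`
  (the initial form ↦ its dehomogenisation; abstract twin of the tree's ✓ `reesChartBase_eval_eq_pow_mul_eval₂`).
* `map_leafSum_eq` — **ONE DIVISION of the normal form**: `ψ(Σ_{e≤μ} t^e v^{k_e} h_e) = ψ(v)^μ · Σ_{e≤μ} t′^e ψ(v)^{e+k_e−μ} ψ(h_e)` for `ψ t = ψ(v)·t′`,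
  `μ ≤ e + k_e`; `eq_leafSum_of_pow_mul_eq` — hence the controlled transform `f′` (`ψ(v)^μ f′ = ψ f`, `ψ v` a non-zero-divisor) IS that sum: the normal form
  REPRODUCES ITSELF with weights `k_e ↦ e + k_e − μ` (for `k_e = (μ−e)d`: `(μ−e)(d−1)`) and coefficients `h_e ↦ ψ h_e` — iterate along the tower.
* `leafSum_base` — THE START: `g_e = G_e(x) + r_e` with `G_e` homogeneous of degree `k_e` in the generators `x` of `𝔪` and `r_e ∈ 𝔪^{k_e+1}` gives, after the
  first division, coefficients `h_e ≡ G_e(y) (mod ψ(x_j))` — the dehomogenised initial forms.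
* `leafSum_sub_mem_of_weights_zero` — THE END: when all weights are `0` (after `d` divisions), `f_d ≡ Σ_e t_d^e g_e (mod v)` for any `g_e ≡ h_e (mod v)`:
  the `δ`-FACE `Σ_e t_d^e C_e` read modulo the exceptional parameter.

Honest framing: OURS, elementary; the solvability of the face (`= C_μ (T + λ)^μ`), the successor `Γ″` and `U|_{Γ″} = −v(c)λ` (memo §2.5) are NOT addressed, nor
any scheme-level identification; nothing here proves X44c, any case of `CleanModels`, or resolution of singularities in characteristic `p`.
[cite: CossartPiltant2008, Prop. 4.4 (proof, p. 11)] [cite: CossartJannsenSaito2020, Lemma 7.5, Def. 7.1]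
-/

noncomputable section

set_option linter.dupNamespace false -- mandated namespace of this single-conjunct summit

namespace Summit.ResolutionOfSingularities.ResolutionOfSingularities.Theorems.RadicialJung.CleanModels

/-! ## §1 Homogeneous forms under a chart map -/

/-- **A homogeneous form under a chart map**: `G` homogeneous of degree `n` in the generators `x` (coefficients in `R`), `ψ(x_i) = v · y_i` for all `i`
⟹ `ψ(G(x)) = v^n · G^ψ(y)`. [folklore] -/
theorem map_eval_eq_pow_mul_eval₂_of_isHomogeneous {R A : Type*} [CommRing R] [CommRing A] (ψ : R →+* A) {σ : Type*} [Fintype σ]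
    (x : σ → R) (v : A) (y : σ → A) (hxy : ∀ i, ψ (x i) = v * y i) {G : MvPolynomial σ R} {n : ℕ} (hG : G.IsHomogeneous n) :
    ψ (MvPolynomial.eval x G) = v ^ n * MvPolynomial.eval₂ ψ y G := by
  classical
  simp only [MvPolynomial.eval_eq, MvPolynomial.eval₂_eq, map_sum, map_mul, map_prod, map_pow, Finset.mul_sum]
  refine Finset.sum_congr rfl fun s hs => ?_
  have hd : s.degree = n := by
    by_contra h
    exact (MvPolynomial.mem_support_iff.mp hs) (hG.coeff_eq_zero h)
  subst hd
  simp only [hxy, mul_pow, Finset.prod_mul_distrib, Finset.prod_pow_eq_pow_sum, Finsupp.degree_apply]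
  ring

/-! ## §2 The normal form `Σ_e t^e v^{k_e} h_e` under one division -/

section Step

variable {A B : Type*} [CommRing A] [CommRing B] (ψ : A →+* B) (μ : ℕ) (k : ℕ → ℕ)

/-- **ONE DIVISION of the normal form.**  `ψ t = ψ(v)·t′` and `μ ≤ e + k_e` for `e ≤ μ` give
`ψ(Σ_{e≤μ} t^e v^{k_e} h_e) = ψ(v)^μ · Σ_{e≤μ} t′^e ψ(v)^{e + k_e − μ} ψ(h_e)`. [cite: CossartJannsenSaito2020, Lemma 7.5] -/
theorem map_leafSum_eq (hk : ∀ e ≤ μ, μ ≤ e + k e) {t v : A} {t' : B} (ht : ψ t = ψ v * t') (h : ℕ → A) :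
    ψ (∑ e ∈ Finset.range (μ + 1), t ^ e * v ^ k e * h e) =
      ψ v ^ μ * ∑ e ∈ Finset.range (μ + 1), t' ^ e * ψ v ^ (e + k e - μ) * ψ (h e) := by
  rw [map_sum, Finset.mul_sum]
  refine Finset.sum_congr rfl fun e he => ?_
  have he' : e ≤ μ := by simpa [Finset.mem_range, Nat.lt_succ_iff] using he
  have hpow : ψ v ^ e * ψ v ^ k e = ψ v ^ μ * ψ v ^ (e + k e - μ) := by
    rw [← pow_add, ← pow_add]; congr 1; have := hk e he'; omega
  rw [map_mul, map_mul, map_pow, map_pow, ht, mul_pow]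
  calc (ψ v) ^ e * t' ^ e * (ψ v) ^ k e * ψ (h e) = (ψ v ^ e * ψ v ^ k e) * (t' ^ e * ψ (h e)) := by ring
    _ = (ψ v ^ μ * ψ v ^ (e + k e - μ)) * (t' ^ e * ψ (h e)) := by rw [hpow]
    _ = ψ v ^ μ * (t' ^ e * ψ v ^ (e + k e - μ) * ψ (h e)) := by ring

/-- **The controlled transform is the new normal form**: if `ψ(v)` is a non-zero-divisor and `ψ(v)^μ · f′ = ψ(f)` for `f = Σ_e t^e v^{k_e} h_e`, then
`f′ = Σ_e t′^e ψ(v)^{e + k_e − μ} ψ(h_e)` — weights `k_e ↦ e + k_e − μ`, coefficients `h_e ↦ ψ(h_e)`. [cite: CossartJannsenSaito2020, Lemma 7.5] -/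
theorem eq_leafSum_of_pow_mul_eq (hk : ∀ e ≤ μ, μ ≤ e + k e) {t v : A} {t' : B} (hv : ψ v ∈ nonZeroDivisors B) (ht : ψ t = ψ v * t')
    (h : ℕ → A) {f' : B} (hf : ψ v ^ μ * f' = ψ (∑ e ∈ Finset.range (μ + 1), t ^ e * v ^ k e * h e)) :
    f' = ∑ e ∈ Finset.range (μ + 1), t' ^ e * ψ v ^ (e + k e - μ) * ψ (h e) := by
  rw [map_leafSum_eq ψ μ k hk ht h] at hf
  exact (mul_cancel_left_mem_nonZeroDivisors (pow_mem hv μ)).mp hf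

/-- The new weights for `k_e = (μ − e)·d` (`d ≥ 1`): `e + k_e − μ = (μ − e)(d − 1)`. [folklore] -/
theorem weight_step {μ e d : ℕ} (he : e ≤ μ) (hd : 1 ≤ d) : e + (μ - e) * d - μ = (μ - e) * (d - 1) := by
  have h1 : (μ - e) * d = (μ - e) * (d - 1) + (μ - e) := by
    rw [show d = (d - 1) + 1 from by omega, Nat.mul_add, mul_one]; rw [show d - 1 + 1 - 1 = d - 1 from by omega]
  omega

end Step

/-! ## §3 The start and the end of the tower -/

section Ends

variable {R A : Type*} [CommRing R] [CommRing A] (ψ : R →+* A)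

/-- **THE START (first division, coefficients)**: with `𝔪 = (x)`, `ψ(x_i) = v·y_i` (`v = ψ(x_j)` the exceptional parameter) and `g = G(x) + r`, `G` homogeneous of
degree `n` in `x`, `r ∈ 𝔪^{n+1}`: `ψ(g) = v^n · h` for some `h` with `h − G^ψ(y) ∈ (v)` — the coefficient after one division is the dehomogenised initial form
modulo the exceptional parameter. [cite: CossartPiltant2008, Prop. 4.4 (proof, p. 11)] -/
theorem leafSum_base {σ : Type*} [Fintype σ] (x : σ → R) (v : A) (y : σ → A)
    (hxy : ∀ i, ψ (x i) = v * y i) {G : MvPolynomial σ R} {n : ℕ} (hG : G.IsHomogeneous n) {r : R}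
    (hr : r ∈ Ideal.span (Set.range x) ^ (n + 1)) :
    ∃ h : A, ψ (MvPolynomial.eval x G + r) = v ^ n * h ∧ h - MvPolynomial.eval₂ ψ y G ∈ Ideal.span {v} := by
  -- `ψ(𝔪) ⊆ (v)`, so `ψ(r) ∈ (v)^{n+1} = (v^{n+1})`
  have h𝔪 : (Ideal.span (Set.range x)).map ψ ≤ Ideal.span {v} := by
    rw [Ideal.map_span, Ideal.span_le]
    rintro _ ⟨_, ⟨i, rfl⟩, rfl⟩
    rw [SetLike.mem_coe, hxy i]
    exact Ideal.mul_mem_right _ _ (Ideal.mem_span_singleton_self v)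
  have hr' : ψ r ∈ Ideal.span {v ^ (n + 1)} := by
    have h1 : ψ r ∈ ((Ideal.span (Set.range x)) ^ (n + 1)).map ψ := Ideal.mem_map_of_mem ψ hr
    rw [Ideal.map_pow] at h1
    rw [← Ideal.span_singleton_pow]
    exact Ideal.pow_right_mono h𝔪 _ h1
  obtain ⟨s, hs⟩ := Ideal.mem_span_singleton'.mp hr'
  refine ⟨MvPolynomial.eval₂ ψ y G + v * s, ?_, ?_⟩
  · rw [map_add, map_eval_eq_pow_mul_eval₂_of_isHomogeneous ψ x v y hxy hG, ← hs]; ring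
  · rw [add_sub_cancel_left]
    exact Ideal.mul_mem_right _ _ (Ideal.mem_span_singleton_self v)

/-- **THE END (all weights zero): the `δ`-face modulo the exceptional parameter.**  If `f = Σ_{e≤μ} t^e v^0 h_e` and `h_e − g_e ∈ (v)` for all `e ≤ μ`, then
`f − Σ_{e≤μ} t^e g_e ∈ (v)`: modulo `v` the element is the face polynomial `Σ_e t̄^e ḡ_e`. [cite: CossartPiltant2008, Prop. 4.4 (proof, p. 11)] -/
theorem leafSum_sub_mem_of_weights_zero {B : Type*} [CommRing B] (μ : ℕ) {t v : B} (h g : ℕ → B)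
    (hhg : ∀ e ≤ μ, h e - g e ∈ Ideal.span {v}) :
    (∑ e ∈ Finset.range (μ + 1), t ^ e * v ^ 0 * h e) - ∑ e ∈ Finset.range (μ + 1), t ^ e * g e ∈ Ideal.span {v} := by
  rw [← Finset.sum_sub_distrib]
  refine Ideal.sum_mem _ fun e he => ?_
  have he' : e ≤ μ := by simpa [Finset.mem_range, Nat.lt_succ_iff] using he
  have h1 : t ^ e * v ^ 0 * h e - t ^ e * g e = t ^ e * (h e - g e) := by ring
  rw [h1]
  exact Ideal.mul_mem_left _ _ (hhg e he')

/-- Congruences modulo `v` propagate along the tower: `h − g ∈ (v)` ⟹ `ψ h − ψ g ∈ (ψ v)`. [folklore] -/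
theorem map_sub_mem_span_map {B : Type*} [CommRing B] (φ : A →+* B) {v h g : A} (hhg : h - g ∈ Ideal.span {v}) :
    φ h - φ g ∈ Ideal.span {φ v} := by
  obtain ⟨s, hs⟩ := Ideal.mem_span_singleton'.mp hhg
  rw [← map_sub, ← hs, map_mul]
  exact Ideal.mul_mem_left _ _ (Ideal.mem_span_singleton_self _)

end Ends

/-! ## Appended (hand-2 g20): the whole tower by induction — after `j` divisions the normal form has weights `(μ−e)(d−j)` -/

section Tower

variable (Aj : ℕ → Type*) [∀ j, CommRing (Aj j)] (ψ : ∀ j, Aj j →+* Aj (j + 1)) (μ d : ℕ)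
  (t v f : ∀ j, Aj j) (h : ∀ j, ℕ → Aj j)

/-- **THE TOWER, `j ≤ d` divisions** (memo 4e §2.5 «chart `u₁`: `t = t_j u₁^j`, `J_j = J·u₁^{−jμ}`»): along a chain of ring maps `ψ_j : A_j → A_{j+1}` with
`ψ_j(v_j) = v_{j+1}` non-zero-divisors (the exceptional parameter `u₁` carried along), `ψ_j(t_j) = v_{j+1}·t_{j+1}` (the strict transforms of the leaf),
controlled transforms `v_{j+1}^μ f_{j+1} = ψ_j(f_j)` and coefficients `h_{j+1,e} = ψ_j(h_{j,e})`: if `f_0 = Σ_{e≤μ} t_0^e v_0^{(μ−e)d} h_{0,e}` («`δ ≥ d`» for the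
element), then for every `j ≤ d`: `f_j = Σ_{e≤μ} t_j^e v_j^{(μ−e)(d−j)} h_{j,e}`. [cite: CossartJannsenSaito2020, Lemma 7.5] [cite: CossartPiltant2008, Prop. 4.4 (proof, p. 11)] -/
theorem leafSum_tower (hv : ∀ j, ψ j (v j) = v (j + 1)) (hvnzd : ∀ j, v (j + 1) ∈ nonZeroDivisors (Aj (j + 1)))
    (ht : ∀ j, ψ j (t j) = v (j + 1) * t (j + 1)) (hf : ∀ j, v (j + 1) ^ μ * f (j + 1) = ψ j (f j))
    (hh : ∀ j e, h (j + 1) e = ψ j (h j e))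
    (h0 : f 0 = ∑ e ∈ Finset.range (μ + 1), t 0 ^ e * v 0 ^ ((μ - e) * d) * h 0 e) :
    ∀ j ≤ d, f j = ∑ e ∈ Finset.range (μ + 1), t j ^ e * v j ^ ((μ - e) * (d - j)) * h j e := by
  intro j
  induction j with
  | zero => intro _; simpa using h0
  | succ j ih =>
    intro hj
    have hprev := ih (by omega)
    have hd1 : 1 ≤ d - j := by omega
    -- one division with weights `k_e = (μ − e)(d − j)`
    have key := eq_leafSum_of_pow_mul_eq (ψ j) μ (fun e => (μ - e) * (d - j))
      (fun e he => by
        have h1 : (μ - e) * 1 ≤ (μ - e) * (d - j) := Nat.mul_le_mul_left _ hd1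
        rw [mul_one] at h1
        omega) (t := t j) (v := v j) (t' := t (j + 1))
      (by rw [hv]; exact hvnzd j) (by rw [hv]; exact ht j) (h j) (f' := f (j + 1)) (by rw [hv, ← hprev]; exact hf j)
    rw [key]
    refine Finset.sum_congr rfl fun e he => ?_
    have he' : e ≤ μ := by simpa [Finset.mem_range, Nat.lt_succ_iff] using he
    rw [hv, ← hh, weight_step he' hd1, show d - j - 1 = d - (j + 1) from by omega]

/-- **At the bottom of the tower (`j = d`) all weights vanish**: `f_d = Σ_{e≤μ} t_d^e · h_{d,e}`, and modulo `v_d` this is the `δ`-FACE `Σ_e t̄_d^e ḡ_e` for any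
`g_e ≡ h_{d,e} (mod v_d)` (e.g. the images of the dehomogenised initial forms, ✓ `leafSum_base` + `map_sub_mem_span_map`). [cite: CossartPiltant2008, Prop. 4.4 (proof, p. 11)] -/
theorem leafSum_tower_bottom (hv : ∀ j, ψ j (v j) = v (j + 1)) (hvnzd : ∀ j, v (j + 1) ∈ nonZeroDivisors (Aj (j + 1)))
    (ht : ∀ j, ψ j (t j) = v (j + 1) * t (j + 1)) (hf : ∀ j, v (j + 1) ^ μ * f (j + 1) = ψ j (f j))
    (hh : ∀ j e, h (j + 1) e = ψ j (h j e))
    (h0 : f 0 = ∑ e ∈ Finset.range (μ + 1), t 0 ^ e * v 0 ^ ((μ - e) * d) * h 0 e)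
    (g : ℕ → Aj d) (hg : ∀ e ≤ μ, h d e - g e ∈ Ideal.span {v d}) :
    f d - ∑ e ∈ Finset.range (μ + 1), t d ^ e * g e ∈ Ideal.span {v d} := by
  have h1 := leafSum_tower Aj ψ μ d t v f h hv hvnzd ht hf hh h0 d le_rfl
  have h2 : f d = ∑ e ∈ Finset.range (μ + 1), t d ^ e * v d ^ 0 * h d e := by
    rw [h1]
    refine Finset.sum_congr rfl fun e _ => by rw [Nat.sub_self, mul_zero]
  rw [h2]
  exact leafSum_sub_mem_of_weights_zero μ (h d) g hg

end Tower

end Summit.ResolutionOfSingularities.ResolutionOfSingularities.Theorems.RadicialJung.CleanModels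

end
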